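import Summits.BirchSwinnertonDyer.Rank1Residual.Additive.KatoDescentRankOneCountRows
import Summits.BirchSwinnertonDyer.Rank1Residual.X12.ClassClosureO10EtaBranch
import Literature.NumberTheory.EllipticCurves.SupersingularIrreducibleProofs
import Literature.NumberTheory.EllipticCurves.IrreducibleModPQuadraticTwistProofs
import Literature.NumberTheory.EllipticCurves.SerreOpenImageOrdinaryInertiaProofs
import HarnessLib

set_option autoImplicit false

/-!
# `W[p]` IS IRREDUCIBLE on the rows of stmt-BirchSwinnertonDyer-19223 (`(p, I₀*)`, `p ≥ 5`), and the FIRST conjunct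
# («an admissible zeta class exists») of `KatoMainConjectureFineContra W p` on those rows RE-KEYED to Kato's
# Prop. 15.21 (first part, CM case) read at a residually irreducible prime — theorems only

Cell `bsd-cm`, seat `bsd-cm-prr-ty1` (literature-prover; item (T19), 2026-08-29; write-crux stmt-BirchSwinnertonDyer-19223,
line `kato_perrin_riou_istar` v6 912f1f77349a4b85). Namespace `Summit.BirchSwinnertonDyer.Rank1Residual.Additive.StrictCount`
(E48's). THEOREMS ONLY: no `def`, no named fact, no `instance`, no notation, no `sorry`; nothing is registered; no stub
of the istar skeleton is closed by this file; nothing is asserted on 19223; BSD is proved for no curve.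

## What, and why

Research stub 2 of the istar line, `stub_katoMainConjectureFineIstarZero : ∀ p ≥ 5, ∀ W, HasSignedLocalType W p (I₀*) →
r_an(W) = 1 → KatoMainConjectureFineContra W p`, MIXES two contents (the `def` body of `KatoMainConjectureFineContra`,
`KatoDescentClosedBindersContra.lean` §1): (∃) «some pinned `𝐇¹_Γ(T_pW)` over a cyclotomic datum carries an ADMISSIBLE zeta
class» — Kato's integrality `Z(f, T_pW) ⊂ 𝐇¹(T_pW)` — and (∀) «for every admissible `z₀` the height-one lengths of the
dual fine Selmer module `X₀^{γ⁻¹}` equal those of `𝐇¹/Λz₀`» — Kato's Conj. 12.10 proper. On the rows the (∃)-part is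
PRINT-BY-PROOF: the row members are CM curves (`HasSignedLocalType.1`) whose residual representation `W[p]` is
IRREDUCIBLE (§1 below: `W ≅ V^{(p*)}` for the good supersingular twin `V` of
`O10.exists_goodTwist_pStar_of_hasSignedLocalType_IstarZero`; `V[p]` irreducible by Serre 1972 Prop. 12 = the tree theorem
`hasIrreducibleModPGaloisRep_of_dvd_frobeniusTrace`; a quadratic twist does not move irreducibility,
`hasIrreducibleModPGaloisRep_iff_of_smul_eq_quadraticTwist`), and at such a prime Kato's Prop. 15.21 (first part)
[Astérisque 295, p. 266; proof p. 267 «in the same way as in the non-CM case in 13.14 by 12.4 (1), 12.6, 14.7, 15.20»]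
gives the integrality — typed Literature-side as the named fact
`Kato2004.exists_isAdmissibleZetaClass_of_hasCM_of_irreducible` (`Kato2004/AdmissibleZetaClassRealisabilityCM.lean`,
companion of F051). §2 re-keys the (∃)-conjunct on the rows to THAT FACT'S BODY taken as a hypothesis `hfact` (its
TYPE is the fact's `def` body verbatim, so a consumer passes the named fact itself — `def` delta — and this file needs
no import of it); §3 reassembles `KatoMainConjectureFineContra W p` on the rows from `hfact` and the (∀)-clause ALONE
(`hlen`, displayed VERBATIM from the `def` body) — the shape a split of stub 2 under the director's RESTUB rule (ii)
(pub/bsd-cm INBOX 2026-08-29T12:57:06Z: «a stub that MIXES print facts with content is SPLIT — facts → the cite stub,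
content → a NEW named stub») would consume: `kmcFine_closed := katoMainConjectureFineContra_istarZero_of_fact_of_lengths
stub_printFactsKato.<F-CM> stub_katoLengthsIstarZero`. Whether to split is the planner's decision; this file only
supplies the heads. On stmt-BirchSwinnertonDyer-19945 (𝒞₇ × {7}) NOTHING analogous holds: `W[7] ⊇ W[√−7]` is a rational
line (residually REDUCIBLE), Kato's §15.19 condition fails identically at `7` for `K = ℚ(√−7)`, and no printed
integrality statement covers an additive residually reducible prime (seat memo `pub/bsd-cm/bsd-cm-prr-ty1/g19/INTEGRALITY-AUDIT.md`).

References: K. Kato, Astérisque 295 (2004), Prop. 15.21 (p. 266) and proof (p. 267), §15.19–15.20 (p. 266), §15.16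
(p. 265), §13.14 (p. 234), Conj. 12.10 (p. 224) [Kato2004Asterisque]; J.-P. Serre, Invent. Math. 15 (1972) §1.11
Prop. 12 [Serre1972]; J. H. Silverman, ATAEC (1994) IV.9.4 Step 6 / Table 4.1 (the twin) [SilvermanATAEC1994],
AEC (2009) X.5 Cor. 5.4 (twists) [SilvermanAEC2009]; tree: `X12/ClassClosureO10EtaBranch.lean`,
`SupersingularIrreducibleProofs.lean`, `IrreducibleModPQuadraticTwistProofs.lean`, `KatoDescentClosedBindersContra.lean`,
`Kato2004/AdmissibleZetaClass.lean`.
-/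

noncomputable section

open scoped Classical NumberField

open WeierstrassCurve Field IsDedekindDomain NumberField Rat.HeightOneSpectrum Literature.NumberTheory.EllipticCurves
  Literature.NumberTheory.EllipticCurves.Rank1Residual Literature.NumberTheory.EllipticCurves.Rank1Residual.Typed
  Literature.NumberTheory.EllipticCurves.Kato2004 Literature.NumberTheory.EllipticCurves.IwasawaAlgebra
  Literature.NumberTheory.GaloisRepresentations
open Summit.BirchSwinnertonDyer.Rank1Residual Summit.BirchSwinnertonDyer.Rank1Residual.Additive
  Summit.BirchSwinnertonDyer.Rank1Residual.X12.O10

namespace Summit.BirchSwinnertonDyer.Rank1Residual.Additive.StrictCount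

/-! ## §1 `W[p]` is irreducible on the type `(p, I₀*)`, `p ≥ 5` -/

section Irreducible

variable (W : WeierstrassCurve ℚ) [W.IsElliptic] (p : ℕ) [hp : Fact p.Prime]

/-- **On the signed local type `(p, I₀*)`, `p ≥ 5`, the residual representation `W[p]` is irreducible.**  The row
member is `ℚ`-isomorphic to the `p*`-twist of a globally minimal CM curve `V` with GOOD reduction at `p` and
`a_p(V) = 0` (`O10.exists_goodTwist_pStar_of_hasSignedLocalType_IstarZero`); `V[p]` is irreducible at an odd prime of
good supersingular reduction (Serre's Prop. 12: the inertia image is cyclic of order `p² − 1`; tree theorem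
`hasIrreducibleModPGaloisRep_of_dvd_frobeniusTrace`), and `W[p] ≅ V[p] ⊗ χ_{p*}` is irreducible with it
(`hasIrreducibleModPGaloisRep_iff_of_smul_eq_quadraticTwist`). Any analytic rank.
[cite: Serre1972, §1.11 Prop. 12] [cite: SilvermanATAEC1994, IV.9.4 Step 6 and Table 4.1] [cite: SilvermanAEC2009, X.5 Cor. 5.4] -/
theorem hasIrreducibleModPGaloisRep_of_hasSignedLocalType_IstarZero (hp5 : 5 ≤ p)
    (hT : HasSignedLocalType W p (.Istar 0)) : W.HasIrreducibleModPGaloisRep p := by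
  have hpP : p.Prime := hp.out
  have hp2 : p ≠ 2 := by omega
  obtain ⟨V, hVe, hVm, C, hC, hgood, hap, -, -, -⟩ :=
    X12.O10.exists_goodTwist_pStar_of_hasSignedLocalType_IstarZero W hT hp5
  have hΔ : ¬ (p : ℤ) ∣ minimalDiscriminantInt V :=
    not_dvd_minimalDiscriminantInt_of_hasGoodReductionAtPrime' V p hgood
  have hirrV : V.HasIrreducibleModPGaloisRep p :=
    hasIrreducibleModPGaloisRep_of_dvd_frobeniusTrace V p hp2 hΔ (by rw [hap]; exact dvd_zero _)
  have hd : ((-1 : ℚ) ^ (p / 2) * p) ≠ 0 :=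
    mul_ne_zero (pow_ne_zero _ (by norm_num)) (by exact_mod_cast hpP.ne_zero)
  have hC' : C⁻¹ • V = W.quadraticTwist ((-1 : ℚ) ^ (p / 2) * p) := by rw [← hC, inv_smul_smul]
  exact (hasIrreducibleModPGaloisRep_iff_of_smul_eq_quadraticTwist W V hd hC' p).mp hirrV

end Irreducible

/-! ## §2 The (∃)-conjunct of `KatoMainConjectureFineContra` on the rows, re-keyed to the CM integrality fact's BODY -/

section Admissible

/-- **The FIRST conjunct of `KatoMainConjectureFineContra W p` on the rows `(p, I₀*)`, `p ≥ 5`, from the BODY of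
`Kato2004.exists_isAdmissibleZetaClass_of_hasCM_of_irreducible`** (hypothesis `hfact`, whose type is that named fact's
`def` body verbatim — pass the fact itself): some cyclotomic `ℤ_p`-extension, topological generator, pinned
`𝐇¹_Γ(T_pW)` and ADMISSIBLE zeta class exist, in the binder order and under the instances
(`Fact p.Prime`, `TateModule.continuousSMul_padicInt`) of the `def` body of `KatoMainConjectureFineContra`.  CM from
`HasSignedLocalType.1`, `¬ CMRamified` from `HasSignedLocalType.2.1` (`CMInert`), `p ≠ 2` from `5 ≤ p`,
irreducibility from §1; the pin by `nonempty_iwasawaH1Data_holds` over `CyclotomicZp.zpExtension`.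
CONDITIONAL on `hfact`; nothing asserted. Any analytic rank.
[cite: Kato2004Asterisque, Prop. 15.21 (first part) (p. 266) and its proof (p. 267); Conj. 12.10 (p. 224)] [cite: Serre1972, §1.11 Prop. 12] -/
theorem exists_isAdmissibleZetaClass_istarZero_of_cmFact
    (hfact : ∀ (W : WeierstrassCurve ℚ) [W.IsElliptic] [W.IsGloballyMinimal] (p : ℕ) [Fact p.Prime]
      [ContinuousSMul ℤ_[p] (W.tateModule p)] (κ : ZpExtension ℚ p) (γ : absoluteGaloisGroup ℚ)
      (hκ : κ.IsCyclotomic), κ.IsTopGenerator γ → p ≠ 2 → W.HasCM → ¬ CMRamified W p →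
        W.HasIrreducibleModPGaloisRep p →
        ∀ I : IwasawaH1Data W p κ γ, ∃ z₀ : I.H, IsAdmissibleZetaClass W p κ hκ I z₀) :
    ∀ (p : ℕ) [Fact p.Prime], 5 ≤ p → ∀ (W : WeierstrassCurve ℚ) [W.IsElliptic] [W.IsGloballyMinimal],
      HasSignedLocalType W p (.Istar 0) →
      letI : ContinuousSMul ℤ_[p] (W.tateModule p) := TateModule.continuousSMul_padicInt
      ∃ (K : ZpExtension ℚ p) (hK : K.IsCyclotomic) (γ : absoluteGaloisGroup ℚ) (_ : K.IsTopGenerator γ)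
        (I : IwasawaH1Data W p K γ) (z₀ : I.H), IsAdmissibleZetaClass W p K hK I z₀ := by
  intro p _ hp5 W _ _ hT
  letI : ContinuousSMul ℤ_[p] (W.tateModule p) := TateModule.continuousSMul_padicInt
  have hirr := hasIrreducibleModPGaloisRep_of_hasSignedLocalType_IstarZero W p hp5 hT
  obtain ⟨γ, hγ, -⟩ := CyclotomicZp.exists_isTopGenerator_zpExtension p
  obtain ⟨I⟩ := nonempty_iwasawaH1Data_holds W p (CyclotomicZp.zpExtension p) γ
    (CyclotomicZp.isCyclotomic_zpExtension p) hγ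
  obtain ⟨z₀, hz₀⟩ :=
    hfact W p (CyclotomicZp.zpExtension p) γ (CyclotomicZp.isCyclotomic_zpExtension p) hγ (by omega) hT.1
      hT.2.1.1 hirr I
  exact ⟨CyclotomicZp.zpExtension p, CyclotomicZp.isCyclotomic_zpExtension p, γ, hγ, I, z₀, hz₀⟩

/-! ## §3 `KatoMainConjectureFineContra` on the rows = the CM integrality fact + Kato's 12.10 LENGTH EQUALITY alone -/

/-- **Reassembly on the rows of stmt-BirchSwinnertonDyer-19223.**  From the body of
`Kato2004.exists_isAdmissibleZetaClass_of_hasCM_of_irreducible` (`hfact`) and the (∀)-clause of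
`KatoMainConjectureFineContra` ALONE on the rank-one pairs of the type (`hlen`, displayed VERBATIM from the `def` body:
for every cyclotomic datum, pin and ADMISSIBLE `z₀`, every dual fine Selmer datum `Y` of key `γ⁻¹` and every height-one
prime `𝔮` of `Λ`, `length_𝔮 Y.X = length_𝔮 (I.H ⧸ Λz₀)` — Kato's Conj. 12.10 in fine-Selmer form, contragredient key),
`KatoMainConjectureFineContra W p` holds at every rank-one pair of the type.  The shape of an in-file `kmcFine_closed`
after a split of research stub 2 into a cite conjunct and a lengths-only research stub (planner's decision; nothing is
registered here).  CONDITIONAL on both displayed hypotheses; 19223 stays OPEN; Kato's Conj. 12.10 is NOT proved.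
[cite: Kato2004Asterisque, Conj. 12.10 (p. 224); Prop. 15.21 (first part) (p. 266)] -/
theorem katoMainConjectureFineContra_istarZero_of_fact_of_lengths
    (hfact : ∀ (W : WeierstrassCurve ℚ) [W.IsElliptic] [W.IsGloballyMinimal] (p : ℕ) [Fact p.Prime]
      [ContinuousSMul ℤ_[p] (W.tateModule p)] (κ : ZpExtension ℚ p) (γ : absoluteGaloisGroup ℚ)
      (hκ : κ.IsCyclotomic), κ.IsTopGenerator γ → p ≠ 2 → W.HasCM → ¬ CMRamified W p →
        W.HasIrreducibleModPGaloisRep p →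
        ∀ I : IwasawaH1Data W p κ γ, ∃ z₀ : I.H, IsAdmissibleZetaClass W p κ hκ I z₀)
    (hlen : ∀ (p : ℕ) [Fact p.Prime], 5 ≤ p → ∀ (W : WeierstrassCurve ℚ) [W.IsElliptic] [W.IsGloballyMinimal],
      HasSignedLocalType W p (.Istar 0) → W.analyticRank = 1 →
      letI : ContinuousSMul ℤ_[p] (W.tateModule p) := TateModule.continuousSMul_padicInt
      ∀ (K : ZpExtension ℚ p) (hK : K.IsCyclotomic) (γ : absoluteGaloisGroup ℚ) (_ : K.IsTopGenerator γ)
        (I : IwasawaH1Data W p K γ) (z₀ : I.H), IsAdmissibleZetaClass W p K hK I z₀ →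
        ∀ (Y : W.FineSelmerDualData K γ⁻¹) (𝔮 : PrimeSpectrum (IwasawaAlgebra p)), 𝔮.asIdeal.height = 1 →
          Module.lengthAt (IwasawaAlgebra p) Y.X 𝔮 =
            Module.lengthAt (IwasawaAlgebra p) (I.H ⧸ (IwasawaAlgebra p) ∙ z₀) 𝔮) :
    ∀ (p : ℕ) [Fact p.Prime], 5 ≤ p → ∀ (W : WeierstrassCurve ℚ) [W.IsElliptic] [W.IsGloballyMinimal],
      HasSignedLocalType W p (.Istar 0) → W.analyticRank = 1 → KatoMainConjectureFineContra W p := by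
  intro p _ hp5 W _ _ hT hr hpP
  exact ⟨exists_isAdmissibleZetaClass_istarZero_of_cmFact hfact p hp5 W hT, hlen p hp5 W hT hr⟩

end Admissible

end Summit.BirchSwinnertonDyer.Rank1Residual.Additive.StrictCount

end
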